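import Mathlib.Analysis.Fourier.FourierTransform
import Mathlib.NumberTheory.LocalField.Basic
import Mathlib.Topology.Algebra.ContinuousMonoidHom
import Mathlib.Analysis.Complex.Circle
import Mathlib.Topology.LocallyConstant.Basic
import Mathlib.MeasureTheory.Integral.Bochner.Basic
import Mathlib.MeasureTheory.Group.Measure
import Mathlib.Analysis.SpecialFunctions.Pow.Complex
import Mathlib.Analysis.SpecialFunctions.Pow.Real
import Mathlib.FieldTheory.RatFunc.AsPolynomial
import Mathlib.FieldTheory.RatFunc.Basic
import Mathlib.RingTheory.Valuation.Discrete.Basic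
import Literature.NumberTheory.GaloisRepresentations.LocalField
import HarnessLib

-- provenance: harness21/H21/H21/Prelude/AutomorphicL/TateLocalFactors.lean @ dac86eb (interim HEAD d8f2665); M5 mechanical rewrite
/-!
# Tate's local theory for `GL₁` over a non-archimedean local field
(AutomorphicL trunk, prelude I16; notion `rankin_selberg_local_factors`, part 1)

Let `F` be a non-archimedean local field with residue field of cardinality `q = q_F`,
normalised absolute value `|·|_F` (`Literature.NumberTheory.GaloisRepresentations.IsNonarchimedeanLocalField.normAbs`), a non-trivial
continuous additive character `ψ : F → 𝕊` and Haar measures `μ = dx` on `F`, `μ' = d×x` on `Fˣ`.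
For a quasi-character `χ : Fˣ → ℂˣ` and a Schwartz–Bruhat function `f` on `F`, Tate's local zeta
integral is `Z(f, χ, s) = ∫_{Fˣ} f(x) χ(x) |x|^s d×x`, and Tate's *local functional equation*
(Tate 1950, Thm. 2.4.1) reads
`Z(f̂, χ⁻¹, 1 - s) = γ(s, χ, ψ) Z(f, χ, s)`, with `γ(s, χ, ψ) = ε(s, χ, ψ) L(1 - s, χ⁻¹) / L(s, χ)`,
`L(s, χ) = (1 - χ(ϖ) q^{-s})⁻¹` for `χ` unramified and `1` otherwise, and
`ε(s, χ, ψ) = e · q^{-a s}` a monomial in `q^{-s}` (Tate 1950 §2.4–2.5; Bushnell–Henniart,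
*The local Langlands conjecture for GL(2)* (2006), §23; Deligne, *Les constantes des équations
fonctionnelles des fonctions L* (1973), §3).

## Design (outline AutomorphicL D5, D8, H7, I16)

* `γ`, `L` and `ε` are honest RATIONAL FUNCTIONS of `T = q^{-s}` (`RatFunc ℂ`), evaluated at
  `T = q^{-s}` by `evalAtQ`. `RatFunc.eval` returns the junk value `0` at poles; every predicate
  below only evaluates at points `s` of an open strip on which the rational function in question
  has no pole (documented per predicate).
* The functional equation is the PREDICATE `HasTateGamma ψ μ μ' χ γ`, imposed for every
  Schwartz–Bruhat `f` and every `s` in the full strip `-σ < re s < 1 - σ` of common convergence,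
  where `σ` is the (unique) real exponent of `χ` (`QuasiChar.HasExponent`). A rational function
  is determined by its values on such a strip, so `∃! γ` is a true theorem
  (`existsUnique_hasTateGamma`). `ε` is monomial data `(e : ℂ, a : ℤ)` (`HasTateEpsilon`).
* Conductor exponents are PREDICATES (`AddChar.HasConductorExp`, `QuasiChar.HasConductorExp`),
  no `sSup` (D8).
* Measurable structures are instance arguments and measures are explicit parameters (H7); the
  measurable structure on `Fˣ` is Mathlib's `Units.instMeasurableSpace`.
* Fourier convention: Tate's `f̂(y) = ∫ f(x) ψ(xy) dx`. Mathlib's `Fourier.fourierIntegral e μ f w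
  = ∫ e(-(v w)) • f v ∂μ` uses the opposite sign, so `fourierSB ψ μ f := Fourier.fourierIntegral
  ψ⁻¹ μ f` (this matters: `ε(s, χ, ψ⁻¹) = χ(-1) ε(s, χ, ψ)`).
* Sign of the `ε`-exponent: `AddChar.HasConductorExp ψ m` uses the Bushnell–Henniart *level*
  (`ψ` trivial on `𝔭^m`, not on `𝔭^{m-1}`), which is `-n(ψ)` in Tate's notation. Hence the
  exponent of `ε(s, χ, ψ) = e · q^{-a s}` is `a = a(χ) - m` (`hasTateEpsilon_exponent`); the
  outline's `a = c + m` was a sign slip (check: `χ = 1`, `f = 1_𝒪`, `f̂ = 1_{𝔭^m}` gives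
  `γ = q^{-m} T^{-m} L(1-s)/L(s)`).

## Mathlib anchors (reused)

`AddChar F Circle` and its group structure (`ψ⁻¹ x = ψ (-x)`; the trivial character is `0 = 1`,
and Mathlib phrases non-triviality as `ψ ≠ 0`), `Fourier.fourierIntegral`,
`IsLocallyConstant`, `HasCompactSupport`, `ContinuousMonoidHom` (`Fˣ →ₜ* ℂˣ`, a `CommGroup`),
`Valuation.IsUniformizer` / `Valuation.Uniformizer` and `Valuation.locally_const`,
`RatFunc.C`, `RatFunc.X`, `RatFunc.eval`, `Polynomial.aeval`, `Units.instMeasurableSpace`.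
Mathlib has no Schwartz–Bruhat space for totally disconnected spaces (its `SchwartzMap` is the
archimedean notion), no quasi-characters of local fields and no local `L`/`ε`-factors.

## Namespaces and dot-notation

Everything lives in `Literature.Automorphic`. `QuasiChar F` is an `abbrev` for `Fˣ →ₜ* ℂˣ` (the type
of G09's `recGL1`), so `QuasiChar.IsUnramified` etc. are used with dot-notation on it.
DELIBERATE DOT-NOTATION EXTENSION of a Mathlib namespace: the two predicates
`AddChar.IsContinuousNontrivial` and `AddChar.HasConductorExp` are declared in Mathlib's
`AddChar` namespace (outline AutomorphicL, review 15), so that `ψ.IsContinuousNontrivial` and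
`ψ.HasConductorExp m` work for `ψ : AddChar F Circle`.
-/

open scoped NNReal
open MeasureTheory ValuativeRel Literature.NumberTheory.GaloisRepresentations.IsNonarchimedeanLocalField

noncomputable section

namespace Literature.NumberTheory.Automorphic

/-! ### Schwartz–Bruhat functions -/

section SchwartzBruhat

variable (X : Type*) [TopologicalSpace X]

/-- The space `𝒮(X)` of *Schwartz–Bruhat functions* on a topological space `X` (intended: a
totally disconnected locally compact space such as a non-archimedean local field or `Fˣ`): the
complex-valued functions that are locally constant and compactly supported (Bruhat 1961;
Tate 1950 §2.2; Bushnell–Henniart 2006, §23.1). A `ℂ`-submodule of `X → ℂ`. [cite: Bruhat1961] -/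
def SchwartzBruhat : Submodule ℂ (X → ℂ) where
  carrier := {f | IsLocallyConstant f ∧ HasCompactSupport f}
  add_mem' hf hg := ⟨hf.1.comp₂ hg.1 (· + ·), hf.2.add hg.2⟩
  zero_mem' := ⟨IsLocallyConstant.const 0, HasCompactSupport.zero⟩
  smul_mem' c _ hf := ⟨hf.1.comp (c • ·), hf.2.smul_left (f := fun _ : X => c)⟩

variable {X}

/-- Membership in the Schwartz–Bruhat space: `f ∈ 𝒮(X)` iff `f` is locally constant and has
compact support (Tate 1950 §2.2; Bushnell–Henniart 2006, §23.1). [cite: Tate1950, §2.2] -/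
@[simp]
theorem mem_schwartzBruhat_iff {f : X → ℂ} :
    f ∈ SchwartzBruhat X ↔ IsLocallyConstant f ∧ HasCompactSupport f :=
  Iff.rfl

end SchwartzBruhat

/-! ### The base field, balls and unit filtration -/

section LocalField

variable (F : Type*) [Field F] [ValuativeRel F] [TopologicalSpace F]
  [IsNonarchimedeanLocalField F]

/-- The fractional ideal `𝔭^m = {x ∈ F | |x|_F ≤ q^{-m}}` (`m : ℤ`) of a non-archimedean local
field, as a subset of `F`; `𝔭^0 = 𝒪_F` (Bushnell–Henniart 2006, §1.1). [cite: BushnellHenniart2006, §1.1] -/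
def primePowBall (m : ℤ) : Set F :=
  {x | normAbs F x ≤ ((residueFieldCard F : ℝ≥0)⁻¹) ^ m}

/-- The unit filtration `U^n_F ⊆ Fˣ`: `U^0 = 𝒪ˣ = {x | |x|_F = 1}` and
`U^n = 1 + 𝔭^n = {x ∈ 𝒪ˣ | |x - 1|_F ≤ q^{-n}}` for `n ≥ 1` (the single formula below covers
both cases since `|x - 1| ≤ 1` whenever `|x| = 1`; Bushnell–Henniart 2006, §1.1). [cite: BushnellHenniart2006, §1.1] -/
def unitFiltration (n : ℕ) : Set Fˣ :=
  {x | normAbs F (x : F) = 1 ∧ normAbs F ((x : F) - 1) ≤ ((residueFieldCard F : ℝ≥0)⁻¹) ^ n}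

variable {F}

/-- The valuation is locally constant on `Fˣ` (Mathlib's `Valuation.locally_const`, transported
along `Units.val`). [folklore] -/
theorem isLocallyConstant_valuation_units :
    IsLocallyConstant fun x : Fˣ => valuation F (x : F) := by
  refine (IsLocallyConstant.iff_eventually_eq _).2 fun x => ?_
  have h : {y : F | valuation F y = valuation F (x : F)} ∈ nhds (x : F) :=
    Valuation.locally_const (valuation F) (by simp)
  exact (Units.continuous_val.tendsto x).eventually h

/-- The normalised absolute value `x ↦ |x|_F` is locally constant on `Fˣ`. [folklore] -/
theorem isLocallyConstant_normAbs_units :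
    IsLocallyConstant fun x : Fˣ => normAbs F (x : F) :=
  (isLocallyConstant_valuation_units (F := F)).comp fun v =>
    WithZeroMulInt.toNNReal (Nat.cast_ne_zero.mpr (residueFieldCard_ne_zero F))
      (_root_.IsNonarchimedeanLocalField.valueGroupWithZeroIsoInt F v)

/-- `|x|_F ≠ 0` for a unit `x` (`|·|_F` is G09's `Literature.NumberTheory.GaloisRepresentations.IsNonarchimedeanLocalField.normAbs`,
an absolute value; Bushnell–Henniart 2006, §1.1). [cite: BushnellHenniart2006, §1.1] -/
theorem normAbs_units_ne_zero (x : Fˣ) : normAbs F (x : F) ≠ 0 := by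
  simp

end LocalField

/-! ### Additive characters, Fourier transform, self-dual measures -/

end Literature.NumberTheory.Automorphic

/-! Two predicates on Mathlib's `AddChar`, deliberately declared in the `AddChar` namespace for
dot-notation (announced in the module docstring; outline AutomorphicL review 15). -/
namespace AddChar

open Literature.NumberTheory.Automorphic

variable {F : Type*} [Field F] [ValuativeRel F] [TopologicalSpace F]
  [IsNonarchimedeanLocalField F]

/-- A *non-trivial continuous additive character* `ψ : F → 𝕊` of a non-archimedean local
field: `ψ` is continuous and is not the trivial character (Mathlib: the trivial `AddChar` is
`0`, definitionally equal to `1`) (Tate 1950 §2.2; Bushnell–Henniart 2006, §1.7). Declared in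
Mathlib's `AddChar` namespace for dot-notation (H21, AutomorphicL prelude I16). [cite: Tate1950, §2.2] -/
def IsContinuousNontrivial (ψ : AddChar F Circle) : Prop :=
  Continuous ψ ∧ ψ ≠ 0

/-- `ψ` has *conductor exponent* `m : ℤ` (BH: "`ψ` has level `m`"): `ψ` is trivial on
`𝔭^m = {x | |x|_F ≤ q^{-m}}` but not on `𝔭^{m-1}` (Tate 1950 §2.2; Bushnell–Henniart 2006,
§1.7 Definition). A predicate: no `sSup` is taken (outline D8). Declared in Mathlib's `AddChar`
namespace for dot-notation (H21, AutomorphicL prelude I16). [cite: Tate1950, §2.2] -/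
def HasConductorExp (ψ : AddChar F Circle) (m : ℤ) : Prop :=
  (∀ x ∈ primePowBall F m, ψ x = 1) ∧ ∃ x ∈ primePowBall F (m - 1), ψ x ≠ 1

end AddChar

namespace Literature.NumberTheory.Automorphic

section Fourier

variable {F : Type*} [Field F] [MeasurableSpace F]

/-- Tate's Fourier transform `f̂(y) = ∫ f(x) ψ(x y) dμ(x)` of `f : F → ℂ` with respect to the
additive character `ψ` and the measure `μ` on `F` (Tate 1950 §2.2; Bushnell–Henniart 2006,
§23.1). This is Mathlib's `Fourier.fourierIntegral` for the character `ψ⁻¹ = ψ(-·)`, whose sign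
convention is the opposite one. [cite: Tate1950, §2.2] -/
def fourierSB (ψ : AddChar F Circle) (μ : Measure F) (f : F → ℂ) : F → ℂ :=
  Fourier.fourierIntegral ψ⁻¹ μ f

/-- Unfolding `fourierSB`: `f̂(y) = ∫ ψ(x y) f(x) dμ(x)`. [folklore] -/
theorem fourierSB_apply (ψ : AddChar F Circle) (μ : Measure F) (f : F → ℂ) (y : F) :
    fourierSB ψ μ f y = ∫ x, (ψ (x * y) : ℂ) * f x ∂μ := by
  simp [fourierSB, Fourier.fourierIntegral_def, Circle.smul_def]

/-- The measure `μ` on `F` is *self-dual* with respect to `ψ`: the Fourier inversion formula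
`(f̂)̂ (x) = f(-x)` holds for every Schwartz–Bruhat function `f` (Tate 1950 §2.2, Thm. 2.2.2;
Bushnell–Henniart 2006, §23.1 Proposition). [cite: Tate1950, §2.2  Thm. 2.2.2] -/
def IsSelfDualMeasure [TopologicalSpace F] (ψ : AddChar F Circle) (μ : Measure F) : Prop :=
  ∀ f ∈ SchwartzBruhat F, fourierSB ψ μ (fourierSB ψ μ f) = fun x => f (-x)

end Fourier

/-! ### Quasi-characters of `Fˣ` -/

/-- A *quasi-character* of `Fˣ`: a continuous homomorphism `χ : Fˣ → ℂˣ` (not necessarily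
unitary) (Tate 1950 §2.3; Bushnell–Henniart 2006, §1.5). An `abbrev` for Mathlib's
`ContinuousMonoidHom`; this is the type of the argument of G09's `recGL1`. [cite: Tate1950, §2.3] -/
abbrev QuasiChar (F : Type*) [Field F] [TopologicalSpace F] : Type _ :=
  Fˣ →ₜ* ℂˣ

section QuasiChar

variable {F : Type*} [Field F] [ValuativeRel F] [TopologicalSpace F]
  [IsNonarchimedeanLocalField F]

namespace QuasiChar

/-- `χ` is *unramified*: `χ` is trivial on the unit group `𝒪ˣ = {x | |x|_F = 1}` (Tate 1950
§2.3; Bushnell–Henniart 2006, §1.5). [cite: Tate1950, §2.3] -/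
def IsUnramified (χ : QuasiChar F) : Prop :=
  ∀ x : Fˣ, normAbs F (x : F) = 1 → χ x = 1

/-- `χ` is *unitary* (a character in Tate's terminology): `|χ(x)| = 1` for all `x`
(Tate 1950 §2.3). [cite: Tate1950, §2.3] -/
def IsUnitary (χ : QuasiChar F) : Prop :=
  ∀ x : Fˣ, ‖(χ x : ℂ)‖ = 1

/-- `χ` has *(real) exponent* `σ`: `|χ(x)| = |x|_F ^ σ` for all `x ∈ Fˣ`, i.e.
`χ = χ₀ · |·|^σ` with `χ₀` unitary (Tate 1950 §2.3: "`σ` = exponent of `χ`"). [cite: Tate1950, §2.3: " σ  = exponent of  χ "] -/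
def HasExponent (χ : QuasiChar F) (σ : ℝ) : Prop :=
  ∀ x : Fˣ, ‖(χ x : ℂ)‖ = ((normAbs F (x : F) : ℝ≥0) : ℝ) ^ σ

/-- Every quasi-character has a unique real exponent: `x ↦ |χ x|` is a continuous
homomorphism `Fˣ → ℝ_{>0}`, trivial on the compact group `𝒪ˣ`, hence of the form `|·|^σ`; and
`σ` is unique because `|ϖ|_F = q⁻¹ ≠ 1` (Tate 1950 §2.3, Lemma 2.3.1). [cite: Tate1950, §2.3  Lemma 2.3.1] -/
def existsUnique_hasExponent : Prop :=
  ∀ (χ : QuasiChar F),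
    ∃! σ : ℝ, χ.HasExponent σ

/-- `χ` has *conductor exponent* `a : ℕ`: `χ` is trivial on the unit filtration group `U^a`
(`U^0 = 𝒪ˣ`, `U^n = 1 + 𝔭^n`) and on no `U^b` with `b < a`; so `a = 0` iff `χ` is unramified
(Tate 1950 §2.3; Bushnell–Henniart 2006, §1.8). A predicate (outline D8). [cite: Tate1950, §2.3] -/
def HasConductorExp (χ : QuasiChar F) (a : ℕ) : Prop :=
  (∀ x ∈ unitFiltration F a, χ x = 1) ∧ ∀ b < a, ∃ x ∈ unitFiltration F b, χ x ≠ 1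

/-- `χ` has conductor exponent `0` iff it is unramified. [folklore] -/
def hasConductorExp_zero_iff : Prop :=
  ∀ {χ : QuasiChar F},
    χ.HasConductorExp 0 ↔ χ.IsUnramified

end QuasiChar

/-- The value `|x|_F ^ s ∈ ℂ` is non-zero for `x ∈ Fˣ`. [folklore] -/
theorem normAbs_cpow_ne_zero (x : Fˣ) (s : ℂ) :
    (((normAbs F (x : F) : ℝ≥0) : ℝ) : ℂ) ^ s ≠ 0 :=
  Complex.cpow_ne_zero_iff.2 (Or.inl (by exact_mod_cast normAbs_units_ne_zero x))

variable (F) in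
/-- The *unramified quasi-character* `ω_s = |·|_F ^ s : Fˣ → ℂˣ` for `s : ℂ` (Tate 1950 §2.3).
It is continuous because `|·|_F` is locally constant on `Fˣ`. [cite: Tate1950, §2.3] -/
def unramifiedTwist (s : ℂ) : QuasiChar F where
  toFun x := Units.mk0 ((((normAbs F (x : F) : ℝ≥0) : ℝ) : ℂ) ^ s) (normAbs_cpow_ne_zero x s)
  map_one' := Units.ext (by simp)
  map_mul' x y := Units.ext (by
    simp only [Units.val_mul, map_mul, NNReal.coe_mul, Complex.ofReal_mul, Units.val_mk0]
    exact Complex.mul_cpow_ofReal_nonneg (NNReal.coe_nonneg _) (NNReal.coe_nonneg _) s)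
  continuous_toFun :=
    ((isLocallyConstant_normAbs_units (F := F)).comp fun r : ℝ≥0 =>
      if h : ((r : ℝ) : ℂ) ^ s = 0 then (1 : ℂˣ) else Units.mk0 _ h).continuous.congr fun x => by
        simp only [Function.comp_apply, dif_neg (normAbs_cpow_ne_zero x s)]

/-- Unfolding `unramifiedTwist`: `ω_s(x) = |x|_F ^ s`. [folklore] -/
@[simp]
theorem unramifiedTwist_apply (s : ℂ) (x : Fˣ) :
    ((unramifiedTwist F s x : ℂˣ) : ℂ) = (((normAbs F (x : F) : ℝ≥0) : ℝ) : ℂ) ^ s :=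
  rfl

/-- `ω_s` is unramified. [folklore] -/
theorem isUnramified_unramifiedTwist (s : ℂ) : (unramifiedTwist F s).IsUnramified := by
  intro x hx
  ext
  simp [hx]

/-- `ω_s` has exponent `re s` (Tate 1950 §2.3). [cite: Tate1950, §2.3] -/
theorem hasExponent_unramifiedTwist (s : ℂ) : (unramifiedTwist F s).HasExponent s.re := by
  intro x
  rw [unramifiedTwist_apply, Complex.norm_cpow_eq_rpow_re_of_pos]
  exact_mod_cast pos_iff_ne_zero.2 (normAbs_units_ne_zero x)

end QuasiChar

/-! ### Local `L`-factors as rational functions of `T = q^{-s}` -/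

section LFactor

/-- Evaluation of a rational function `R(T) ∈ ℂ(T)` at `T = q^{-s}`:
`evalAtQ q R s = R(q^{-s})`. Uses `RatFunc.eval`, which returns the junk value `0` when `q^{-s}`
is a pole of `R` (outline D8; every use below evaluates off the poles). Shared with the
Rankin–Selberg file. [folklore] -/
def evalAtQ (q : ℕ) (R : RatFunc ℂ) (s : ℂ) : ℂ :=
  R.eval (RingHom.id ℂ) ((q : ℂ) ^ (-s))

variable {F : Type*} [Field F] [ValuativeRel F] [TopologicalSpace F]
  [IsNonarchimedeanLocalField F]

open scoped Classical in
/-- The inverse local `L`-factor `P_χ(T) ∈ ℂ[T]` of a quasi-character, `L(s, χ) = P_χ(q^{-s})⁻¹`: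
`P_χ = 1 - χ(ϖ) T` if `χ` is unramified (then `χ(ϖ)` does not depend on the uniformiser `ϖ`,
`χ` being trivial on `𝒪ˣ`), and `P_χ = 1` otherwise (Tate 1950 §2.4;
Bushnell–Henniart 2006, §23.2). The uniformiser is `Classical.arbitrary`; it enters only in
the unramified case (outline D8). [cite: Tate1950, §2.4] -/
def tateEulerFactor (χ : QuasiChar F) : Polynomial ℂ :=
  if χ.IsUnramified then
    letI ϖ : (valuation F).Uniformizer := Classical.arbitrary _
    1 - Polynomial.C ((χ (Units.mk0 ((ϖ : 𝒪[F]) : F)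
      (by exact_mod_cast Valuation.Uniformizer.ne_zero ϖ)) : ℂˣ) : ℂ) * Polynomial.X
  else 1

/-- `P_χ = 1` for ramified `χ`. [folklore] -/
theorem tateEulerFactor_of_not_isUnramified {χ : QuasiChar F} (h : ¬ χ.IsUnramified) :
    tateEulerFactor χ = 1 := by
  simp [tateEulerFactor, h]

/-- `P_χ = 1 - χ(ϖ) T` for unramified `χ` and ANY uniformiser `ϖ` (independence of the
uniformiser; Tate 1950 §2.4). [cite: Tate1950, §2.4] -/
def tateEulerFactor_of_isUnramified : Prop :=
  ∀ {χ : QuasiChar F} (h : χ.IsUnramified) {ϖ : F} (hϖ : (valuation F).IsUniformizer ϖ),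
    tateEulerFactor χ = 1 - Polynomial.C ((χ (Units.mk0 ϖ hϖ.ne_zero) : ℂˣ) : ℂ) *
      Polynomial.X

/-- `L(s, χ)` as a rational function of `T = q^{-s}`: `P_χ(T)⁻¹ ∈ ℂ(T)` (Tate 1950 §2.4). [cite: Tate1950, §2.4] -/
def tateLRat (χ : QuasiChar F) : RatFunc ℂ :=
  (algebraMap (Polynomial ℂ) (RatFunc ℂ) (tateEulerFactor χ))⁻¹

variable (F) in
/-- The substitution `T ↦ q⁻¹ T⁻¹` (i.e. `s ↦ 1 - s` on `T = q^{-s}`) as an element of `ℂ(T)`. [folklore] -/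
def dualVar : RatFunc ℂ :=
  RatFunc.C ((residueFieldCard F : ℂ)⁻¹) * RatFunc.X⁻¹

/-- `L(1 - s, χ⁻¹)` as a rational function of `T = q^{-s}`: `P_{χ⁻¹}(q⁻¹ T⁻¹)⁻¹ ∈ ℂ(T)`,
since `q^{-(1-s)} = q⁻¹ T⁻¹` (Tate 1950 §2.4). [cite: Tate1950, §2.4] -/
def tateLRatDual (χ : QuasiChar F) : RatFunc ℂ :=
  (Polynomial.aeval (dualVar F) (tateEulerFactor χ⁻¹))⁻¹

/-- The local `L`-factor `L(s, χ) = P_χ(q^{-s})⁻¹ ∈ ℂ`; equals `(1 - χ(ϖ) q^{-s})⁻¹` for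
unramified `χ` and `1` otherwise (Tate 1950 §2.4; Bushnell–Henniart 2006, §23.2). At the poles
(`χ(ϖ) q^{-s} = 1`) the value is the junk `0` of `RatFunc.eval` (outline D8). [cite: Tate1950, §2.4] -/
def tateLFactor (χ : QuasiChar F) (s : ℂ) : ℂ :=
  evalAtQ (residueFieldCard F) (tateLRat χ) s

/-- The `ε`-factor `ε(s) = e · q^{-a s}` as the monomial `e · T^a ∈ ℂ(T)` (`a : ℤ`)
(Tate 1950 §2.5; Deligne 1973 §3). [cite: Tate1950, §2.5] -/
def tateEpsilonRat (e : ℂ) (a : ℤ) : RatFunc ℂ :=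
  RatFunc.C e * RatFunc.X ^ a

end LFactor

/-! ### Zeta integrals and the local functional equation -/

section Zeta

variable {F : Type*} [Field F] [ValuativeRel F] [TopologicalSpace F]
  [IsNonarchimedeanLocalField F] [MeasurableSpace F]

/-- Tate's local zeta integral `Z(f, χ, s) = ∫_{Fˣ} f(x) χ(x) |x|_F^s dμ'(x)` for `f : F → ℂ`,
a quasi-character `χ`, `s : ℂ` and a measure `μ'` on `Fˣ` (Tate 1950 §2.4;
Bushnell–Henniart 2006, §23.2). A Bochner integral: junk `0` when not integrable; it converges
for `f` Schwartz–Bruhat and `re s > -σ`, `σ` the exponent of `χ`. [cite: Tate1950, §2.4] -/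
def tateZeta (μ' : Measure Fˣ) (f : F → ℂ) (χ : QuasiChar F) (s : ℂ) : ℂ :=
  ∫ x : Fˣ, f (x : F) * ((χ x : ℂˣ) : ℂ) * (((normAbs F (x : F) : ℝ≥0) : ℝ) : ℂ) ^ s ∂μ'

variable [BorelSpace F]

/-- **Tate's local functional equation with `γ`-factor `γ ∈ ℂ(T)`** (Tate 1950, Thm. 2.4.1;
Bushnell–Henniart 2006, §23.3–23.4): for the exponent `σ` of `χ`, every Schwartz–Bruhat `f`
and every `s` in the strip `-σ < re s < 1 - σ` (where both zeta integrals converge absolutely),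
`Z(f̂, χ⁻¹, 1 - s) = γ(q^{-s}) · Z(f, χ, s)`.
The true `γ(s, χ, ψ) = ε(s, χ, ψ) L(1 - s, χ⁻¹) / L(s, χ)` has no pole in this open strip, so
`evalAtQ` never meets its junk value there. [cite: Tate1950, Thm. 2.4.1] -/
def HasTateGamma (ψ : AddChar F Circle) (μ : Measure F) (μ' : Measure Fˣ) (χ : QuasiChar F)
    (γ : RatFunc ℂ) : Prop :=
  ∀ σ : ℝ, χ.HasExponent σ → ∀ f ∈ SchwartzBruhat F, ∀ s : ℂ, -σ < s.re → s.re < 1 - σ →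
    tateZeta μ' (fourierSB ψ μ f) χ⁻¹ (1 - s) =
      evalAtQ (residueFieldCard F) γ s * tateZeta μ' f χ s

/-- **Tate's local `ε`-factor as monomial data** `(e, a)`: `ε(s, χ, ψ) = e · q^{-a s}` and the
functional equation holds with `γ = ε(s, χ, ψ) · L(1 - s, χ⁻¹) / L(s, χ)`, all three read as
rational functions of `T = q^{-s}` (Tate 1950 §2.4–2.5; Bushnell–Henniart 2006, §23.4;
Deligne 1973 §3). [cite: Tate1950, §2.4–2.5] -/
def HasTateEpsilon (ψ : AddChar F Circle) (μ : Measure F) (μ' : Measure Fˣ) (χ : QuasiChar F)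
    (e : ℂ) (a : ℤ) : Prop :=
  HasTateGamma ψ μ μ' χ (tateEpsilonRat e a * tateLRatDual χ / tateLRat χ)

variable (ψ : AddChar F Circle) (μ : Measure F) (μ' : Measure Fˣ) (χ : QuasiChar F)

/-- **Existence and uniqueness of Tate's `γ`-factor** (Tate 1950, Thm. 2.4.1 and §2.5;
Bushnell–Henniart 2006, §23.4 Theorem): for `ψ` continuous non-trivial and Haar measures
`μ` on `F`, `μ'` on `Fˣ`, there is a unique `γ ∈ ℂ(T)` satisfying the local functional equation.
Uniqueness: some `f` has `Z(f, χ, s) ≠ 0` on the strip, and a rational function is determined by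
its values at the infinitely many points `q^{-s}`, `s` in the strip. [cite: Tate1950, Thm. 2.4.1 and §2.5] -/
def existsUnique_hasTateGamma : Prop :=
  ∀ (hψ : ψ.IsContinuousNontrivial) [μ.IsAddHaarMeasure] [μ'.IsHaarMeasure],
    ∃! γ : RatFunc ℂ, HasTateGamma ψ μ μ' χ γ

/-- **Existence and uniqueness of Tate's `ε`-factor** (Tate 1950 §2.5; Bushnell–Henniart 2006,
§23.4–23.5; Deligne 1973 §3): there is a unique pair `(e, a) ∈ ℂ × ℤ` with
`ε(s, χ, ψ) = e · q^{-a s}`. [cite: Tate1950, §2.5] -/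
def existsUnique_hasTateEpsilon : Prop :=
  ∀ (hψ : ψ.IsContinuousNontrivial) [μ.IsAddHaarMeasure] [μ'.IsHaarMeasure],
    ∃! ea : ℂ × ℤ, HasTateEpsilon ψ μ μ' χ ea.1 ea.2

variable {ψ μ μ' χ}

/-- The constant `e = ε(0, χ, ψ)` of the `ε`-factor is non-zero (Tate 1950 §2.5;
Bushnell–Henniart 2006, §23.5). [cite: Tate1950, §2.5] -/
def hasTateEpsilon_ne_zero : Prop :=
  ∀ (hψ : ψ.IsContinuousNontrivial) [μ.IsAddHaarMeasure] [μ'.IsHaarMeasure] {e : ℂ} {a : ℤ} (h : HasTateEpsilon ψ μ μ' χ e a),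
    e ≠ 0

/-- The exponent of the `ε`-factor: if `ψ` has conductor exponent (level) `m` and `χ` has
conductor exponent `c`, then `ε(s, χ, ψ) = e · q^{-(c - m) s}`, i.e. `a = c - m` (Tate 1950 §2.5,
where Tate's `n(ψ) = -m`; Bushnell–Henniart 2006, §23.5 Proposition:
`ε(s, χ, ψ(b·)) = χ(b) |b|^{s-1} ε(s, χ, ψ)`). See the module docstring for the sign. [cite: Tate1950, §2.5  where Tate's  n(ψ] -/
def hasTateEpsilon_exponent : Prop :=
  ∀ (hψ : ψ.IsContinuousNontrivial) [μ.IsAddHaarMeasure] [μ'.IsHaarMeasure] {e : ℂ} {a : ℤ} (h : HasTateEpsilon ψ μ μ' χ e a) {m : ℤ} {c : ℕ} (hm : ψ.HasConductorExp m) (hc : χ.HasConductorExp c),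
    a = c - m

/-- The unramified computation (Tate 1950 §2.5, the case "`χ` unramified, `𝔡 = 𝒪`";
Bushnell–Henniart 2006, §23.5): if `χ` is unramified, `ψ` has conductor exponent `0` (trivial
on `𝒪`, not on `𝔭⁻¹`) and `μ(𝒪) = 1` (so that `μ` is self-dual for `ψ`), then
`ε(s, χ, ψ) = 1`, i.e. `Z(f̂, χ⁻¹, 1 - s) = L(1 - s, χ⁻¹) / L(s, χ) · Z(f, χ, s)`. [cite: Tate1950, §2.5  the case " χ  unramified   𝔡 = 𝒪 "] -/
def hasTateEpsilon_unramified : Prop :=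
  ∀ (hψ : ψ.IsContinuousNontrivial) [μ.IsAddHaarMeasure] [μ'.IsHaarMeasure] (hχ : χ.IsUnramified) (hm : ψ.HasConductorExp 0) (hμ : μ (primePowBall F 0) = 1),
    HasTateEpsilon ψ μ μ' χ 1 0

end Zeta

end Literature.NumberTheory.Automorphic
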